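/-
Copyright (c) 2026 the pub-hodgecm-mathlib formalisation cell (harness21).  Prover seat hodgecm-mathlib-K2Liu-p23 (g3), Track B «K2-LIT»,
#184♮ = hLiu418 = `stmt-HodgeConjecture-24832`; #42F′ FACE-G organ F4 (G-gen), road (E), B3-b: (E-g-glue-Std) — ★ FILE 3's LETTER (partner) AT `t := tupleVec`
FOR A STANDARD IWASAWA DATUM, modulo the ONE arch-leg reading letter `hread` (F4 desk K2Liu-p27 (g3) WORD #2 (5) 2026-09-05T00:42:24Z, re-scoped 00:47:41Z
after ★ p863778).
KERNEL: theorems only.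
-/
import Summits.HodgeConjecture.HodgeConjecture.Theorems.K2LiuArchSWDataPartnerGlue             -- ★ p863611 (E-g-glue): `hpartner_of_hermitePartner` (span (range tupleVec) = Fock-finite vectors of `frameD`)
import Summits.HodgeConjecture.HodgeConjecture.Theorems.K2LiuArchSWTruncationSectionsFinite   -- ★ p863778 (LH7-p05): `partner_letter_of_isStd` (the (E-g) head for standard `𝒦`, modulo `hread`)
import Summits.HodgeConjecture.HodgeConjecture.Theorems.K2LiuArchSWTruncationReading           -- ★ p863883 (LH7-p05): `partner_letter_of_frameUnitary` (`hread` paid modulo the frame-unitarity `hKU`) (ED. 2)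
import HarnessLib

/-!
# Crux `HLiu418`, FACE-G organ F4, road (E), B3-b (E-g-glue-Std): ★ FILE 3's letter (partner) at `t := tupleVec` for a STANDARD Iwasawa datum,
# modulo the one arch-leg reading letter `hread`

Cell `hodgecm-mathlib`, crux item hLiu418 = `stmt-HodgeConjecture-24832`, route of record `HCCMUnconditional`; squad K2 ∕ K2Liu, socket #42F′, FACE-G organ
F4 (G-gen), road (E), B3-b; F4 desk K2Liu-p27 (g3); consumers: F4-END `K2LiuFaceGGeneratorsInDomainOfRecord` (K2Liu-p27 (g3)), ★ FILE 3
`K2LiuArchSWDataFinalPassage.forall_domain_good_of_archGenerators` (K2E3-p23), LH7-p07 (g2)'s `…Final`; box K2E5-r02 (g7) ∕ K2Liu-audit1.  THEOREMS ONLY (no `def`,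
no `instance`, no `notation`, no named-fact hypothesis, no `sorry`); lane `--supports stmt-HodgeConjecture-24832 --as helper` (count-neutral helper, closes no socket).

WHAT.  ★ p863778 `K2LiuArchSWTruncationSectionsFinite.partner_letter_of_isStd` (LH7-p05 (g2)) proves the (E-g) «polynomial partner» head — ★ FILE 3's letter
(partner) at `t := follandHermite frameD` — for every STANDARD Iwasawa datum `𝒦` (`𝒦.IsStd`) modulo ONE by-value letter `hread` (the arch-leg reading of
`ω(sB(k ⊗ 1))` on pure tensors for `k ∈ 𝒦.K`, existential form: a framed operator `x` over a unitary `u`, a scalar `c` and a finite-slot linear map `B`).  ★ p863611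
`K2LiuArchSWDataPartnerGlue.hpartner_of_hermitePartner` moves any such head to `t := tupleVec` (the tuple vectors span exactly the Fock-finite vectors of `frameD`).
THIS FILE is their composition, so that F4-END binds ★ FILE 3's `hpartner` at `t := tupleVec` with residue `{h𝒦, hread}` only:
* **`hpartner_of_isStd (h𝒦 : 𝒦.IsStd) (hread : ‹★ partner_letter_of_isStd's bytes›) : ‹★ FILE 3 :170–173 at t := tupleVec, VERBATIM›`**.
* (ED. 2) **`hpartner_of_frameUnitary (h𝒦) (ht hodd) (hKU : ‹★ partner_letter_of_frameUnitary's bytes›) : ‹same›`** — `hread` paid by ★ p863883 `hread_of_frameUnitary`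
  modulo the FRAME-UNITARITY letter `hKU` (payable on the sign-frame-adapted arch class only — chair K2-lead (g2) 00:48:04Z, K2E3-p31 (g2) 00:59:25Z).
References: [Howe1989] §3 (Fock-finite vectors = polynomial Fock model); [Folland1989] §1.7 (1.81), §4.2 Prop. (4.39); [KudlaRallis1994] §1 Thm. 1.1 (Siegel–Weil
sections, Iwasawa decomposition); [Knapp1986] Ch. VII §1 (matrix coefficients) — citations only, the file is a two-line composition.
HONEST LABEL.  Count-neutral helper: `HC_CM` is proved only modulo the 7 printed citations (2 remaining named inputs: hLiu418 = `stmt-HodgeConjecture-24832`,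
h413 = `stmt-HodgeConjecture-24833`) until rung 0 closes; this file closes no socket.
-/

set_option autoImplicit false
set_option linter.dupNamespace false -- the mandated namespace repeats `HodgeConjecture.HodgeConjecture`

noncomputable section

open scoped Classical Matrix TensorProduct SchwartzMap
open NumberField NumberField.InfinitePlace NumberField.mixedEmbedding IsDedekindDomain
open Literature.Analysis.SegalBargmann Literature.RepresentationTheory.HeisenbergGroup
open Literature.NumberTheory.Automorphic Literature.NumberTheory.Automorphic.UnitaryGroup Literature.NumberTheory.GaloisRepresentations
open Literature.NumberTheory.Weil1964 Literature.NumberTheory.Weil1964.MpS Literature.NumberTheory.Weil1964.UnitaryWeil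
open Literature.RepresentationTheory.HarrisKudlaSweet1996
open Literature.RepresentationTheory.KonnoKonno2007 Literature.RepresentationTheory.KonnoKonno2007.RealDualPair
open Literature.NumberTheory.GelbartRogawski1991 Literature.NumberTheory.GelbartRogawski1991.GRConstruction
open Literature.NumberTheory.GelbartRogawski1991.UnitaryDualPair
open Literature.NumberTheory.GelbartRogawski1991.UnitaryDualPair.LocalSplitting
open Literature.NumberTheory.K2Lit.SiegelDoubled
open Literature.NumberTheory.Automorphic.Liu2021
open Literature.NumberTheory.Automorphic.Liu2021.Def411WeilCarriers
open Literature.NumberTheory.Automorphic.Liu2021.Def411WeilCarriersDoubling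
open Literature.RepresentationTheory.Liu2021
open Summit.HodgeConjecture.HodgeConjecture.Cruxes.HLiu418.K2LiuArchSectionPlaceBlock
open Summit.HodgeConjecture.HodgeConjecture.Cruxes.HLiu418.K2LiuArchSWDataTuplesDefs
open Summit.HodgeConjecture.HodgeConjecture.Cruxes.HLiu418.K2LiuFaceGLetterDefs (IsArchStable genFamily)
open Summit.HodgeConjecture.HodgeConjecture.Cruxes.HLiu418.K2LiuArchSWDataPartnerGlue (hpartner_of_hermitePartner)
open Summit.HodgeConjecture.HodgeConjecture.Cruxes.HLiu418.K2LiuArchSWTruncationSectionsFinite (partner_letter_of_isStd)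
open Summit.HodgeConjecture.HodgeConjecture.Cruxes.HLiu418.K2LiuArchSWTruncationReading (partner_letter_of_frameUnitary)

namespace Summit.HodgeConjecture.HodgeConjecture.Cruxes.HLiu418.K2LiuArchSWDataPartnerOfIsStd

variable (L : Type) [Field L] [NumberField L] [IsCMField L] {n : ℕ} (e : Fin 2 × Fin 1 ≃ Fin n)
  (dV : Fin 2 → L) (hdV : ∀ i, IsCMField.complexConj L (dV i) = dV i) (hdV0 : ∀ i, dV i ≠ 0)
  (dW : Fin 1 → L) (hdW : ∀ i, IsCMField.complexConj L (dW i) = dW i) (hdW0 : ∀ i, dW i ≠ 0)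
  {M' n' : ℕ} (eW : Fin 1 × Fin 3 ≃ Fin M') (e' : Fin 2 × Fin M' ≃ Fin n')
  (dV' : Fin 3 → L) (hdV' : ∀ k, IsCMField.complexConj L (dV' k) = dV' k) (hdV'0 : ∀ k, dV' k ≠ 0)
  (χb : HeckeCharacter L) (hχbu : χb.IsUnitary) (hχbs : Literature.RepresentationTheory.HarrisKudlaSweet1996.IsSplittingChar L 1 χb)
  (α : UnitaryGroup.adelicOne (Fp L) L (IsCMField.complexConj L) →* ℂˣ) (𝒦 : IwasawaDatum L e dV hdV dW hdW)
  -- the block data of ★ Final ∕ ★ FILE 2c (`P = Q = Fin 2`); no `Fintype ∕ DecidableEq` instance on `R S` is needed (★ `tupleVec` takes none)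
  (R S : {v : InfinitePlace (Fp L) // v.IsReal} → Type)
  (eP : ∀ σ : {v : InfinitePlace (Fp L) // v.IsReal}, PosIdx (signVec (cmPlaceOver L) (fun k => Sum.elim (cmGramEntry L e' dV hdV (tensorFrame L dW eW dV') (tensorFrame_real L dW hdW eW dV' hdV')) (-cmGramEntry L e' dV hdV (tensorFrame L dW eW dV') (tensorFrame_real L dW hdW eW dV' hdV')) ((LocalSplitting.e₂ n').symm k)) (imagUnit L) σ) ≃ (Fin 2 × R σ) ⊕ (Fin 2 × S σ))
  (eQ : ∀ σ : {v : InfinitePlace (Fp L) // v.IsReal}, NegIdx (signVec (cmPlaceOver L) (fun k => Sum.elim (cmGramEntry L e' dV hdV (tensorFrame L dW eW dV') (tensorFrame_real L dW hdW eW dV' hdV')) (-cmGramEntry L e' dV hdV (tensorFrame L dW eW dV') (tensorFrame_real L dW hdW eW dV' hdV')) ((LocalSplitting.e₂ n').symm k)) (imagUnit L) σ) ≃ (Fin 2 × S σ) ⊕ (Fin 2 × R σ))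

/-- **(partner) AT `t := tupleVec` FOR A STANDARD IWASAWA DATUM, modulo `hread`.**  For `𝒦` standard (`𝒦.IsStd`) and the arch-leg reading `hread` of
`ω(sB(k ⊗ 1))`, `k ∈ 𝒦.K`, on pure tensors (existential form, bytes of ★ `partner_letter_of_isStd`: a framed operator `x ∈ Mp^𝓢` over a unitary `u`, a scalar `c`
and a finite-slot linear map `B` with `ω(sB(k ⊗ 1))(E(a ⊗ φ)) = c • E((frameD^* x frameD_*) a ⊗ B φ)`), ★ FILE 3 `forall_domain_good_of_archGenerators`' letter `hpartner`
holds at `t := tupleVec` — bytes :170–173 VERBATIM: every `a ∈ V` (`V` finite-dimensional, arch-stable) has for each `f` a partner `w ∈ span (range tupleVec)` with the same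
generator family `g_{E(w ⊗ f)} = g_{E(a ⊗ f)}` (★ p863778 `partner_letter_of_isStd` ∘ ★ p863611 `hpartner_of_hermitePartner`).
[cite: Howe1989, §3] [cite: KudlaRallis1994, §1 Thm. 1.1] [cite: Knapp1986, Ch. VII §1] [cite: Folland1989, §1.7 (1.81), §4.2 Prop. (4.39)] -/
theorem hpartner_of_isStd (h𝒦 : 𝒦.IsStd)
    (hread : ∀ k ∈ 𝒦.K, ∃ (x : MpS (Fin (n' + n') × {v : InfinitePlace (Fp L) // v.IsReal}))
      (u : Matrix.unitaryGroup (Fin (n' + n') × {v : InfinitePlace (Fp L) // v.IsReal}) ℂ) (c : ℂ)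
      (B : FinSB (Fp L) (Fin (n' + n')) →ₗ[ℂ] FinSB (Fp L) (Fin (n' + n'))),
      MpS.proj x = realifySp (Fin (n' + n') × {v : InfinitePlace (Fp L) // v.IsReal}) u ∧
      ∀ (a : 𝓢(((Fin (n' + n')) → mixedSpace (Fp L)), ℂ)) (φ : FinSB (Fp L) (Fin (n' + n'))),
        adelicMpCont.omega (Fp L) (Fin (n' + n')) (gramDA L e' dV hdV (tensorFrame L dW eW dV') (tensorFrame_real L dW hdW eW dV' hdV'))
            ((doubledWeilRep L e' dV hdV hdV0 (tensorFrame L dW eW dV') (tensorFrame_real L dW hdW eW dV' hdV')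
                  (tensorFrame_ne_zero L dW eW dV' hdW0 hdV'0) χb hχbu hχbs) (tensorEmb L e dV hdV dW hdW eW e' dV' hdV' k))
            (piSchwartzBruhatEquiv (Fp L) (Fin (n' + n')) (a ⊗ₜ[ℂ] φ)) =
          c • piSchwartzBruhatEquiv (Fp L) (Fin (n' + n'))
            (carrierConjEquiv (frameD L e' dV hdV hdV0 (tensorFrame L dW eW dV') (tensorFrame_real L dW hdW eW dV' hdV')
                (tensorFrame_ne_zero L dW eW dV' hdW0 hdV'0)) x.1.2 a ⊗ₜ[ℂ] B φ)) :
    ∀ (V : Submodule ℂ 𝓢(((Fin (n' + n')) → mixedSpace (Fp L)), ℂ)), FiniteDimensional ℂ V → IsArchStable L e dV hdV hdV0 dW hdW hdW0 eW e' dV' hdV' hdV'0 χb hχbu hχbs 𝒦 V →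
      ∀ a ∈ V, ∀ f : FinSB (Fp L) (Fin (n' + n')), ∃ w ∈ Submodule.span ℂ (Set.range (tupleVec L dV hdV hdV0 dW hdW hdW0 eW e' dV' hdV' hdV'0 R S eP eQ)),
        genFamily L e dV hdV hdV0 dW hdW hdW0 eW e' dV' hdV' hdV'0 χb hχbu hχbs α 𝒦 (piSchwartzBruhatEquiv (Fp L) (Fin (n' + n')) (w ⊗ₜ[ℂ] f)) =
          genFamily L e dV hdV hdV0 dW hdW hdW0 eW e' dV' hdV' hdV'0 χb hχbu hχbs α 𝒦 (piSchwartzBruhatEquiv (Fp L) (Fin (n' + n')) (a ⊗ₜ[ℂ] f)) :=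
  hpartner_of_hermitePartner L e dV hdV hdV0 dW hdW hdW0 eW e' dV' hdV' hdV'0 χb hχbu hχbs α 𝒦 R S eP eQ
    (partner_letter_of_isStd L e dV hdV hdV0 dW hdW hdW0 eW e' dV' hdV' hdV'0 χb hχbu hχbs α 𝒦 h𝒦 hread)

/-- **(ED. 2) (partner) AT `t := tupleVec` MODULO THE FRAME-UNITARITY LETTER `hKU`.**  For `𝒦` standard, `χb` of odd unitary archimedean type `(t, 0)` (`ht hodd`, ★
`IsSplittingChar.exists_hasUnitaryArchType_odd` at the tie) and the frame-unitarity `hKU` of the arch leg of `𝒦.K` in the big scaled Folland frame (bytes of ★ p863883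
`partner_letter_of_frameUnitary`; PAYABLE ONLY on the sign-frame-adapted arch class — off it the phase is a conjugate of a realified unitary), ★ FILE 3's letter `hpartner`
holds at `t := tupleVec`, VERBATIM (★ p863883 `partner_letter_of_frameUnitary` ∘ ★ p863611 `hpartner_of_hermitePartner`).
[cite: Howe1989, §3] [cite: KudlaRallis1994, §1 Thm. 1.1] [cite: Folland1989, §4.2 Prop. (4.39)] [cite: GelbartRogawski1991, §3.1 Prop. 3.1.1 p. 455] -/
theorem hpartner_of_frameUnitary (h𝒦 : 𝒦.IsStd)
    {t : InfinitePlace L → ℤ} (ht : χb.HasUnitaryArchType t 0) (hodd : ∀ w, Odd (t w))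
    (hKU : ∀ k ∈ 𝒦.K, ∃ u : Matrix.unitaryGroup (Fin (n' + n') × {v : InfinitePlace (Fp L) // v.IsReal}) ℂ,
      MpS.proj (archWeilSectionS L (IsCMField.complexConj L) (n' + n') (IsCMField.complexConj_ne_one L) (cmPlaceOver L) (cmPlaceOver_smul L)
        (cmPlaceOver_comap L) _ (gramD_gram_realDiagonal_entry_ne_zero L e' dV hdV (tensorFrame L dW eW dV') (tensorFrame_real L dW hdW eW dV' hdV') hdV0
          (tensorFrame_ne_zero L dW eW dV' hdW0 hdV'0))
        (gramD_eq_diagonal_cm L e' dV hdV (tensorFrame L dW eW dV') (tensorFrame_real L dW hdW eW dV' hdV'))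
        (J := hermD L e' dV hdV (tensorFrame L dW eW dV') (tensorFrame_real L dW hdW eW dV' hdV')) rfl (complexConj_imagUnit L) (imagUnit_ne_zero L)
        (UnitaryGroup.archPart (Fp L) L (IsCMField.complexConj L) (n' + n')
          (hermD L e' dV hdV (tensorFrame L dW eW dV') (tensorFrame_real L dW hdW eW dV' hdV')) (tensorEmb L e dV hdV dW hdW eW e' dV' hdV' k))) =
        realifySp (Fin (n' + n') × {v : InfinitePlace (Fp L) // v.IsReal}) u) :
    ∀ (V : Submodule ℂ 𝓢(((Fin (n' + n')) → mixedSpace (Fp L)), ℂ)), FiniteDimensional ℂ V → IsArchStable L e dV hdV hdV0 dW hdW hdW0 eW e' dV' hdV' hdV'0 χb hχbu hχbs 𝒦 V →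
      ∀ a ∈ V, ∀ f : FinSB (Fp L) (Fin (n' + n')), ∃ w ∈ Submodule.span ℂ (Set.range (tupleVec L dV hdV hdV0 dW hdW hdW0 eW e' dV' hdV' hdV'0 R S eP eQ)),
        genFamily L e dV hdV hdV0 dW hdW hdW0 eW e' dV' hdV' hdV'0 χb hχbu hχbs α 𝒦 (piSchwartzBruhatEquiv (Fp L) (Fin (n' + n')) (w ⊗ₜ[ℂ] f)) =
          genFamily L e dV hdV hdV0 dW hdW hdW0 eW e' dV' hdV' hdV'0 χb hχbu hχbs α 𝒦 (piSchwartzBruhatEquiv (Fp L) (Fin (n' + n')) (a ⊗ₜ[ℂ] f)) :=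
  hpartner_of_hermitePartner L e dV hdV hdV0 dW hdW hdW0 eW e' dV' hdV' hdV'0 χb hχbu hχbs α 𝒦 R S eP eQ
    (partner_letter_of_frameUnitary L e dV hdV hdV0 dW hdW hdW0 eW e' dV' hdV' hdV'0 χb hχbu hχbs α 𝒦 h𝒦 ht hodd hKU)

end Summit.HodgeConjecture.HodgeConjecture.Cruxes.HLiu418.K2LiuArchSWDataPartnerOfIsStd

end
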